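import Mathlib
import HarnessLib
import Summits.NavierStokesRegularity.NavierStokesRegularity.Theorems.PoloidalWindowDoorPoloidalWindowRigidityZShockHeightEvolution

/-!
# Crux K2 `PoloidalWindowRigidity` (stmt-NavierStokesRegularity-19708), line `z_shock` — THICK ⇒ GENUINELY NONLINEAR, and the R3 ENTRANCE
# PACKAGE derived from the deciding stub's own hypotheses

`--supports stmt-NavierStokesRegularity-19708 --as helper` (leafhand-ns-poloidalwindowdoor-2 g0, 2026-08-31).  **No stub and no summit is
closed by this file; Navier–Stokes regularity is NOT proved here.**

Rung R3 of the card (`Lines/z_shock.md` §Hardest stub) is about «a two-sided eternal bounded solution of the AUTONOMOUS equation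
`w_zz + Δₕ[𝒢(w)] = 0` with GENUINE NONLINEARITY `𝒢'' = G' ≠ 0` (= THICK) and hyperbolicity `G < 0`».  The tree now derives every item of
that input from the hypotheses of `stub_zShockThickAut`:

* `exists_deriv_ne_zero_of_thick` — class-free: if on an open space–time window `W₁` the slope law holds with a time-indexed family of
  slope functions `G t`, differentiable at the values, and the window is THICK in the stubs' sense (no `(t, x₂)`-slope function on any open
  sub-window), then `∂_sG t (v₂(t,x)) ≠ 0` at some window point (otherwise `G t` is constant on the connected value set of each small slice
  ball — mean value theorem — and `m(t, ·) := G t (v₂(t, x₀))` is a `(t, x₂)`-slope function on a product sub-window);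
* `r3_entrance_of_class` — class entry: class binders of the stub (Type-I rate, continuity, Oseen identity, divergence-free, poloidal), a
  window `W` with `∇ₕv₂ ≠ 0`, hyperbolicity and thickness on `W`, and the LOCAL autonomy clause on `W₁ ⊆ W` at `z₀` ⇒ there are a window
  time `t₁`, a ball `B` with `{t₁} × B ⊆ W₁` and ONE `G : ℝ → ℝ`, real-analytic at the values `v₂(t₁, x)` (`x ∈ B`), such that on `B` the
  slice `t₁` obeys the slope law `∂_z v_b = G(v₂)·∂_b v₂`, the autonomous height-evolution equation
  `∂₂∂₂v₂ = −(G(v₂)Δₕv₂ + G'(v₂)|∇ₕv₂|²)`, hyperbolicity `G(v₂) < 0`, and genuine nonlinearity is WITNESSED: `G'(v₂(t₁,x₁)) ≠ 0` at some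
  `x₁ ∈ B` (hence, `G'` being analytic, on a dense open set of values near `v₂(t₁,x₁)`).

Honest scope: the witness time `t₁` is SOME time of a product sub-window around `z₀`, not necessarily `t₀ = z₀.1` (thickness is a window
property; a single slice may be linearly degenerate); the package is local (a ball), while R3 needs the two-sided eternal statement along the
whole height axis — that globalisation is exactly L0 (`…ZShockSlopeFunctionConnected`) plus the topology of `{∇ₕv₂ = 0}`, and R3 itself is
not in print. [folklore]
-/

noncomputable section

namespace Summit.NavierStokesRegularity.NavierStokesRegularity.Theorems.PoloidalWindowDoorPoloidalWindowRigidityZShockGenuineNonlinearity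

-- the problem directory repeats the summit name (`NavierStokesRegularity/NavierStokesRegularity`)
set_option linter.dupNamespace false

open Set Filter Topology Function Metric
open Literature.Analysis Literature.Analysis.FluidPDE
open Summit.NavierStokesRegularity.NavierStokesRegularity.Theorems.PoloidalWindowDoorPoloidalWindowRigidityZShockHeightEvolution

/-! ## Class-free: thickness forces a non-zero derivative of the slope function -/

/-- **THICK ⇒ genuinely nonlinear somewhere.**  Let `W₁ ⊆ ℝ × ℝ³` be open and nonempty, `x ↦ v(t,x)₂` continuous at the window points,
and suppose the slope law `∂_z v_b = G t (v₂)·∂_b v₂` (`b = 0, 1`) holds on `W₁` with `G t` differentiable at the values (derivative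
`G' t`).  If the window is THICK — for every `m : ℝ → ℝ → ℝ` and every nonempty open `W' ⊆ W₁` some point of `W'` violates
`∂_z v_b = m(t, x₂)·∂_b v₂` — then `G' t (v₂(t,x)) ≠ 0` at some `(t, x) ∈ W₁`. [folklore] -/
theorem exists_deriv_ne_zero_of_thick {v : ℝ → EuclideanSpace ℝ (Fin 3) → EuclideanSpace ℝ (Fin 3)}
    {W₁ : Set (ℝ × EuclideanSpace ℝ (Fin 3))} (hW₁ : IsOpen W₁) (hne : W₁.Nonempty)
    (hcont : ∀ z ∈ W₁, ContinuousAt (fun x => v z.1 x 2) z.2)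
    {G G' : ℝ → ℝ → ℝ} (hG : ∀ z ∈ W₁, HasDerivAt (G z.1) (G' z.1 (v z.1 z.2 2)) (v z.1 z.2 2))
    (haut : ∀ z ∈ W₁, ∀ b : Fin 3, b ≠ 2 →
      fderiv ℝ (v z.1) z.2 (EuclideanSpace.single 2 1) b =
        G z.1 (v z.1 z.2 2) * fderiv ℝ (v z.1) z.2 (EuclideanSpace.single b 1) 2)
    (hthick : ∀ m : ℝ → ℝ → ℝ, ∀ W' : Set (ℝ × EuclideanSpace ℝ (Fin 3)), W' ⊆ W₁ → IsOpen W' → W'.Nonempty →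
      ∃ z ∈ W', ∃ b : Fin 3, b ≠ 2 ∧
        fderiv ℝ (v z.1) z.2 (EuclideanSpace.single 2 1) b ≠
          m z.1 (z.2 2) * fderiv ℝ (v z.1) z.2 (EuclideanSpace.single b 1) 2) :
    ∃ z ∈ W₁, G' z.1 (v z.1 z.2 2) ≠ 0 := by
  by_contra hcon
  push Not at hcon
  -- a product sub-window `I × B ⊆ W₁` around a point `z₀`
  obtain ⟨z₀, hz₀⟩ := hne
  obtain ⟨u, hu, w, hw, huw⟩ := mem_nhds_prod_iff.1 (hW₁.mem_nhds hz₀)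
  obtain ⟨δ, hδ, hδu⟩ := Metric.mem_nhds_iff.1 hu
  obtain ⟨ρ, hρ, hρw⟩ := Metric.mem_nhds_iff.1 hw
  set W' : Set (ℝ × EuclideanSpace ℝ (Fin 3)) := ball z₀.1 δ ×ˢ ball z₀.2 ρ with hW'
  have hW'sub : W' ⊆ W₁ := fun z hz => huw ⟨hδu hz.1, hρw hz.2⟩
  have hW'o : IsOpen W' := isOpen_ball.prod isOpen_ball
  have hW'ne : W'.Nonempty := ⟨z₀, mem_ball_self hδ, mem_ball_self hρ⟩
  -- on each slice ball, `G t` is constant on the (connected) set of values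
  have hconstG : ∀ t ∈ ball z₀.1 δ, ∀ x ∈ ball z₀.2 ρ, G t (v t x 2) = G t (v t z₀.2 2) := by
    intro t ht x hx
    -- the value set `S = v₂(t, ball)` is preconnected, and `G t` has zero derivative on it
    set φ : EuclideanSpace ℝ (Fin 3) → ℝ := fun y => v t y 2 with hφ
    have hφc : ContinuousOn φ (ball z₀.2 ρ) := fun y hy =>
      (hcont (t, y) (hW'sub ⟨ht, hy⟩)).continuousWithinAt
    have hS : IsPreconnected (φ '' ball z₀.2 ρ) := (convex_ball z₀.2 ρ).isPreconnected.image φ hφc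
    have hSord : OrdConnected (φ '' ball z₀.2 ρ) := isPreconnected_iff_ordConnected.1 hS
    have hzero : ∀ s ∈ φ '' ball z₀.2 ρ, HasDerivAt (G t) 0 s := by
      rintro s ⟨y, hy, rfl⟩
      have h := hG (t, y) (hW'sub ⟨ht, hy⟩)
      rwa [hcon (t, y) (hW'sub ⟨ht, hy⟩)] at h
    -- mean value theorem between the two values
    have key : ∀ a b : ℝ, a ∈ φ '' ball z₀.2 ρ → b ∈ φ '' ball z₀.2 ρ → a < b → G t b = G t a := by
      intro a b ha hb hab
      have hIcc : Icc a b ⊆ φ '' ball z₀.2 ρ := hSord.out ha hb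
      have hcG : ContinuousOn (G t) (Icc a b) := fun s hs => (hzero s (hIcc hs)).continuousAt.continuousWithinAt
      have hdG : ∀ s ∈ Ioo a b, HasDerivAt (G t) 0 s := fun s hs => hzero s (hIcc (Ioo_subset_Icc_self hs))
      obtain ⟨c, hc, hc'⟩ := exists_hasDerivAt_eq_slope (G t) (fun _ => (0 : ℝ)) hab hcG hdG
      have hba : b - a ≠ 0 := sub_ne_zero.2 hab.ne'
      have : G t b - G t a = 0 := by
        have h := hc'.symm
        rw [div_eq_iff hba, zero_mul] at h
        linarith
      linarith
    have ha : φ x ∈ φ '' ball z₀.2 ρ := ⟨x, hx, rfl⟩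
    have hb : φ z₀.2 ∈ φ '' ball z₀.2 ρ := ⟨z₀.2, mem_ball_self hρ, rfl⟩
    rcases lt_trichotomy (φ x) (φ z₀.2) with h | h | h
    · exact (key _ _ ha hb h).symm
    · exact congrArg (G t) h
    · exact key _ _ hb ha h
  -- hence `m(t, ·) := G t (v₂(t, x₀))` is a `(t, x₂)`-slope function on `W'`: contradiction
  obtain ⟨z, hz, b, hb, hneq⟩ := hthick (fun t _ => G t (v t z₀.2 2)) W' hW'sub hW'o hW'ne
  exact hneq (by rw [haut z (hW'sub hz) b hb, hconstG z.1 hz.1 z.2 hz.2])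

/-! ## Class entry: the R3 entrance package -/

/-- **The R3 entrance package from the deciding stub's hypotheses.**  Class binders of `stub_zShockThickAut` (Type-I time rate, continuity
on the slab, unit-viscosity Oseen identity, divergence-free, poloidal), a window `W` in the slab on which `∇ₕv₂ ≠ 0`, the window is
hyperbolic (`∂_z v₀∂₀v₂ + ∂_z v₁∂₁v₂ < 0`) and THICK, and the LOCAL autonomy clause on an open `W₁ ⊆ W` at `z₀ ∈ W₁` ⇒ there are a time
`t₁`, a ball `B = ball c r` with `{t₁} × B ⊆ W₁`, and ONE `G : ℝ → ℝ`, real-analytic at the values `v₂(t₁,x)`, `x ∈ B`, such that on `B`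
the slice `v(t₁,·)` satisfies: the slope law `∂_z v_b = G(v₂)·∂_b v₂` (`b ≠ 2`); the autonomous height-evolution equation
`∂₂∂₂v₂ = −(G(v₂)(∂₀∂₀v₂ + ∂₁∂₁v₂) + G'(v₂)((∂₀v₂)² + (∂₁v₂)²))`, `G' = deriv G`; hyperbolicity `G(v₂) < 0`; and genuine nonlinearity
witnessed, `G'(v₂(t₁,x₁)) ≠ 0` for some `x₁ ∈ B`. [folklore] -/
theorem r3_entrance_of_class (C : ℝ) (v : ℝ → EuclideanSpace ℝ (Fin 3) → EuclideanSpace ℝ (Fin 3))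
    (hrate : Literature.Analysis.FluidPDE.HasTypeITimeDecay C v)
    (hcont : ContinuousOn (Function.uncurry v) (Set.Iio (0 : ℝ) ×ˢ Set.univ))
    (hmild : ∀ s t : ℝ, s < t → t < 0 → ∀ x, v t x =
      Literature.Analysis.UnboundedOperators.heatExtension (v s) (t - s) x -
        Literature.Analysis.FluidPDE.oseenDuhamel 1 s v v t x)
    (hdiv : ∀ t < 0, Literature.Analysis.FluidPDE.VectorCalculus.IsDivFree (v t))
    (hpol : ∀ s < 0, ∀ y, inner ℝ (Literature.Analysis.FluidPDE.curl (v s) y) (EuclideanSpace.single 2 1) = 0)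
    {W : Set (ℝ × EuclideanSpace ℝ (Fin 3))} (hWs : W ⊆ Set.Iio (0 : ℝ) ×ˢ Set.univ)
    (hnd : ∀ z ∈ W, fderiv ℝ (v z.1) z.2 (EuclideanSpace.single 0 1) 2 ≠ 0 ∨
      fderiv ℝ (v z.1) z.2 (EuclideanSpace.single 1 1) 2 ≠ 0)
    (hhyp : ∀ z ∈ W,
      fderiv ℝ (v z.1) z.2 (EuclideanSpace.single 2 1) 0 * fderiv ℝ (v z.1) z.2 (EuclideanSpace.single 0 1) 2 +
        fderiv ℝ (v z.1) z.2 (EuclideanSpace.single 2 1) 1 * fderiv ℝ (v z.1) z.2 (EuclideanSpace.single 1 1) 2 < 0)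
    (hthick : ∀ m : ℝ → ℝ → ℝ, ∀ W' : Set (ℝ × EuclideanSpace ℝ (Fin 3)), W' ⊆ W → IsOpen W' → W'.Nonempty →
      ∃ z ∈ W', ∃ b : Fin 3, b ≠ 2 ∧
        fderiv ℝ (v z.1) z.2 (EuclideanSpace.single 2 1) b ≠
          m z.1 (z.2 2) * fderiv ℝ (v z.1) z.2 (EuclideanSpace.single b 1) 2)
    {W₁ : Set (ℝ × EuclideanSpace ℝ (Fin 3))} (hW₁W : W₁ ⊆ W) (hW₁ : IsOpen W₁)
    {z₀ : ℝ × EuclideanSpace ℝ (Fin 3)} (hz₀ : z₀ ∈ W₁) {g : ℝ → ℝ → ℝ}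
    (haut : ∀ z ∈ W₁, ∀ b : Fin 3, b ≠ 2 →
      fderiv ℝ (v z.1) z.2 (EuclideanSpace.single 2 1) b =
        g z.1 (v z.1 z.2 2) * fderiv ℝ (v z.1) z.2 (EuclideanSpace.single b 1) 2) :
    ∃ (t₁ : ℝ) (c : EuclideanSpace ℝ (Fin 3)) (r : ℝ) (G : ℝ → ℝ), 0 < r ∧
      (∀ x ∈ ball c r, (t₁, x) ∈ W₁) ∧
      (∀ x ∈ ball c r, AnalyticAt ℝ G (v t₁ x 2)) ∧
      (∀ x ∈ ball c r, ∀ b : Fin 3, b ≠ 2 →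
        fderiv ℝ (v t₁) x (EuclideanSpace.single 2 1) b = G (v t₁ x 2) * fderiv ℝ (v t₁) x (EuclideanSpace.single b 1) 2) ∧
      (∀ x ∈ ball c r,
        fderiv ℝ (fun y => fderiv ℝ (v t₁) y (EuclideanSpace.single 2 1) 2) x (EuclideanSpace.single 2 1) =
          -(G (v t₁ x 2) *
                (fderiv ℝ (fun y => fderiv ℝ (v t₁) y (EuclideanSpace.single 0 1) 2) x (EuclideanSpace.single 0 1) +
                  fderiv ℝ (fun y => fderiv ℝ (v t₁) y (EuclideanSpace.single 1 1) 2) x (EuclideanSpace.single 1 1)) +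
              deriv G (v t₁ x 2) *
                (fderiv ℝ (v t₁) x (EuclideanSpace.single 0 1) 2 ^ 2 + fderiv ℝ (v t₁) x (EuclideanSpace.single 1 1) 2 ^ 2))) ∧
      (∀ x ∈ ball c r, G (v t₁ x 2) < 0) ∧
      (∃ x₁ ∈ ball c r, deriv G (v t₁ x₁ 2) ≠ 0) := by
  have hW₁s : W₁ ⊆ Set.Iio (0 : ℝ) ×ˢ Set.univ := hW₁W.trans hWs
  -- a product sub-window `I × B ⊆ W₁` around `z₀`
  obtain ⟨u, hu, w, hw, huw⟩ := mem_nhds_prod_iff.1 (hW₁.mem_nhds hz₀)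
  obtain ⟨δ, hδ, hδu⟩ := Metric.mem_nhds_iff.1 hu
  obtain ⟨ρ, hρ, hρw⟩ := Metric.mem_nhds_iff.1 hw
  set I : Set ℝ := ball z₀.1 δ with hI
  set B : Set (EuclideanSpace ℝ (Fin 3)) := ball z₀.2 ρ with hB
  have hIB : I ×ˢ B ⊆ W₁ := fun z hz => huw ⟨hδu hz.1, hρw hz.2⟩
  -- on each slice `t ∈ I`: the analytic slope function of the ball `B` and the equation (`heightEvolution_of_class_autonomy`)
  have hslice : ∀ t ∈ I, ∃ G : ℝ → ℝ, (∀ x ∈ B, AnalyticAt ℝ G (v t x 2)) ∧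
      (∀ x ∈ B, ∀ b : Fin 3, b ≠ 2 → fderiv ℝ (v t) x (EuclideanSpace.single 2 1) b =
        G (v t x 2) * fderiv ℝ (v t) x (EuclideanSpace.single b 1) 2) ∧
      ∀ x ∈ B, fderiv ℝ (fun y => fderiv ℝ (v t) y (EuclideanSpace.single 2 1) 2) x (EuclideanSpace.single 2 1) =
        -(G (v t x 2) *
              (fderiv ℝ (fun y => fderiv ℝ (v t) y (EuclideanSpace.single 0 1) 2) x (EuclideanSpace.single 0 1) +
                fderiv ℝ (fun y => fderiv ℝ (v t) y (EuclideanSpace.single 1 1) 2) x (EuclideanSpace.single 1 1)) +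
            deriv G (v t x 2) *
              (fderiv ℝ (v t) x (EuclideanSpace.single 0 1) 2 ^ 2 + fderiv ℝ (v t) x (EuclideanSpace.single 1 1) 2 ^ 2)) := by
    intro t ht
    have hzt : (t, z₀.2) ∈ W₁ := hIB ⟨ht, mem_ball_self hρ⟩
    exact heightEvolution_of_class_autonomy C v hrate hcont hmild hdiv hpol hW₁ hW₁s (z₀ := (t, z₀.2)) hzt haut
      (Ω := B) (convex_ball z₀.2 ρ).isPreconnected isOpen_ball (fun x hx => hnd (t, x) (hW₁W (hIB ⟨ht, hx⟩)))
  choose! Gf hGfA hGfslope hGfeq using hslice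
  -- thickness ⇒ a non-zero derivative somewhere in `I × B`
  have hcontz : ∀ z ∈ I ×ˢ B, ContinuousAt (fun x => v z.1 x 2) z.2 := by
    intro z hz
    have ht : z.1 < 0 := (Set.mem_prod.1 (hW₁s (hIB hz))).1
    have h1 : ContinuousAt (Function.uncurry v) (z.1, z.2) :=
      hcont.continuousAt ((isOpen_Iio.prod isOpen_univ).mem_nhds (Set.mk_mem_prod ht (Set.mem_univ _)))
    have h2 : ContinuousAt (fun x => Function.uncurry v (z.1, x)) z.2 :=
      h1.comp (continuousAt_const.prodMk continuousAt_id)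
    exact ((EuclideanSpace.proj (2 : Fin 3)).continuous.continuousAt).comp h2
  obtain ⟨z₁, hz₁, hne⟩ := exists_deriv_ne_zero_of_thick (v := v) (W₁ := I ×ˢ B) (isOpen_ball.prod isOpen_ball)
    ⟨z₀, mem_ball_self hδ, mem_ball_self hρ⟩ hcontz (G := Gf) (G' := fun t s => deriv (Gf t) s)
    (fun z hz => (hGfA z.1 hz.1 z.2 hz.2).differentiableAt.hasDerivAt)
    (fun z hz b hb => hGfslope z.1 hz.1 z.2 hz.2 b hb)
    (fun m W' hW' hW'o hW'ne => hthick m W' (hW'.trans (hIB.trans hW₁W)) hW'o hW'ne)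
  -- the package at the witness time `t₁ = z₁.1`
  refine ⟨z₁.1, z₀.2, ρ, Gf z₁.1, hρ, fun x hx => hIB ⟨hz₁.1, hx⟩, fun x hx => hGfA z₁.1 hz₁.1 x hx,
    fun x hx b hb => hGfslope z₁.1 hz₁.1 x hx b hb, fun x hx => hGfeq z₁.1 hz₁.1 x hx, fun x hx => ?_, ⟨z₁.2, hz₁.2, hne⟩⟩
  -- hyperbolicity ⇒ `G < 0`
  have hzW : (z₁.1, x) ∈ W := hW₁W (hIB ⟨hz₁.1, hx⟩)
  exact (slope_neg_of_hyperbolic (hGfslope z₁.1 hz₁.1 x hx 0 (by decide)) (hGfslope z₁.1 hz₁.1 x hx 1 (by decide))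
    (hhyp (z₁.1, x) hzW)).1

end Summit.NavierStokesRegularity.NavierStokesRegularity.Theorems.PoloidalWindowDoorPoloidalWindowRigidityZShockGenuineNonlinearity

end
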